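/-
Copyright (c) 2026 the pub-hodgecm-mathlib formalisation cell (harness21).  Prover seat hodgecm-mathlib-LH4-p12 (g4), Track A «(D-RAM) FOUR-FRAME», unit U2H, the census leaf
(ρ2b′-X) `stub_U2H_fixedPointCensus_typeTwo_unit0` — PAYER-PLAN-rho2bX v2 brick T4 «order lattices», part III = T4c «the HERMITIAN dual `Λ^# = y⁻¹Λ`» (dictionary D4).  2026-09-04.
-/
import Literature.NumberTheory.LocalFields.QuadraticOrderLattices   -- ★ p857040 (part II: Mars, lattice multipliers, lattice trace dual) → ★ p857021 (part I: orders, Euler trace dual)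
import HarnessLib

/-!
# The hermitian dual of an order lattice: for `Λ = x₀·(𝒪_E + c𝒪_M)` and the form `(a, b) ↦ Tr_{M∕E}(h·Θ(a)·b)` one has `Λ^# = y⁻¹·Λ` with
# `y = h·x₀Θ(x₀)·c(α − ρα)`; hence `Λ ⊆ Λ^# ⟺ y ∈ 𝒪_E + c𝒪_M`, `μΛ^# ⊆ Λ ⟺ μ∕y ∈ 𝒪_E + c𝒪_M`, `Λ ⊆ e·Λ^# ⟺ y∕e ∈ 𝒪_E + c𝒪_M`
(Serre, *Local Fields* Ch. III §6 Prop. 11 (Euler) — transported through the adjoint involution `Θ`; Jacobowitz 1962 §4 (duals and scales of hermitian lattices))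

Topic `NumberTheory/LocalFields`; namespace `Literature.NumberTheory.LocalFields.QuadraticOrder` (= ★ parts I–II `QuadraticOrderIntegralBasis` p857021, `QuadraticOrderLattices`
p857040).  THEOREMS ONLY (no definition, no instance, no notation, no named fact, no `sorry`); kernel lane `--supports stmt-HodgeConjecture-24833` (count-neutral).  Cell
`pub/hodgecm-mathlib` (D-0151), crux H413, Track A «(D-RAM) FOUR-FRAME», unit U2H: dictionary D4 of the toric ∕ order reduction of the WILD type-(2) fixed-point census (ρ2b′-X)
(LH4-p12 (g3) PAYER-PLAN-rho2bX v2; LH4-p14 (g3) RHO2BX-ORGANS v1 row T4 «`Λ^# = y⁻¹Λ`, integrality ∕ primitivity ∕ depth in terms of `y`»).  In the reduction the plane `W` is a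
line `M·w₀` over the biquadratic field `M = E(λ)`, the hermitian form of `W` read on `M` is `(a, b) ↦ Tr_{M∕E}(h·Θ(a)·b)` for the ADJOINT INVOLUTION `Θ` of `M` (the Galois
involution fixing the third quadratic subfield `K♮`; `Θ|_E = σ`, `Θρ = ρΘ`) and a scalar `h ∈ K♮ˣ`; a `λ`-stable lattice is `Λ = x₀·𝒪_j` (★ part II, Mars), and THIS FILE computes
its dual: **`Λ^# = y⁻¹Λ`, `y := h·N_Θ(x₀)·c(α − ρα)`** (`N_Θ(x₀) = x₀Θ(x₀)`), from the ★ Euler dual `𝒪_j^* = (c(α − ρα))⁻¹𝒪_j` of part I and the `Θ`-stability of `𝒪_j`.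

CURRENCY: as parts I–II (one field `K` = model of `M`, `Valued K ℤᵐ⁰`, `ρ` an isometric involution, `α` with `ρα ≠ α` and the integral-power-basis hypothesis `hint`, the order of
conductor `c` = the spelled-out predicate `|z| ≤ 1 ∧ |z − ρz| ≤ |c(α − ρα)|`), PLUS a second ring endomorphism `Θ : K →+* K` with `hΘρ : Θ(ρ x) = ρ(Θ x)`, `hvΘ : |Θ x| = |x|`
and, where surjectivity on the order is needed, `hΘΘ : ΘΘ = id`.  The trace is spelled `t + ρ t`; the hermitian pairing of `a, b ∈ M` is `h·Θ(a)·b + ρ(h·Θ(a)·b)`; a LATTICE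
`Λ = x₀·(order)` is an `AddSubgroup K` with `hΛ : x ∈ Λ ↔ ∃ a, (order predicate) a ∧ x = x₀·a` (the shape ★ `exists_eq_mul_order` delivers).  No hermitian-symmetry hypothesis
on `h` is needed for the dual formula (it is where `h ∈ K♮` would enter).

* §0 `hint` BY NAME, binder-free form (REF5 R5-131): `map_ne_self_of_v_eq_exp_neg_one` (base parity + `|α| = exp(−1)` ⇒ `ρα ≠ α`) and
  **`forall_v_bCoord_le_one_of_v_eq_exp_neg_one`** (base parity + `|α| = exp(−1)` ⇒ `hint`; = ★ part II `v_bCoord_le_one_of_even_log`, i.e. ★ (Π5)).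
* §1 `Θ` PRESERVES EVERY ORDER (`Θρ = ρΘ`, `Θ` isometric): `theta_mem_order`; with `ΘΘ = id` it is onto: `exists_theta_eq_of_mem_order`.
* §2 THE HERMITIAN DUAL: **`forall_v_herm_le_one_iff`** — `|Tr(h·Θ(x₀a)·b)| ≤ 1` for all `a` in the order of conductor `c` iff `c(α − ρα)·(h·Θ(x₀)·b)` lies in that order;
  lattice form **`forall_mem_v_herm_le_one_iff`** (`Λ = x₀·(order)`); and the `y`-FORM **`forall_mem_v_herm_le_one_iff_exists`**: `b ∈ Λ^# ⟺ b = y⁻¹·(x₀·a)` with `a` in the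
  order — `Λ^# = y⁻¹Λ`, `y = h·x₀Θ(x₀)·c(α − ρα)`.
* §3 CONSEQUENCES in terms of `y` (★ multiplier criteria of parts I–II): **INTEGRALITY** `forall_mem_forall_mem_v_herm_le_one_iff` (`Λ ⊆ Λ^# ⟺ y` in the order);
  **DEPTH ∕ MODULARITY** `forall_dual_mul_mem_iff` (`μ·Λ^# ⊆ Λ ⟺ μ∕y` in the order — the census's depth condition `(λ − u)Λ^# ⊆ Λ ⟺ (λ − u) ∈ y𝒪_j`);
  **SCALE ∕ PRIMITIVITY** `forall_mem_exists_dual_eq_mul_iff` (`Λ ⊆ e·Λ^# ⟺ y∕e` in the order, `e ≠ 0` — Gram-primitive iff this FAILS at `e = ϖ_E`).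
HONEST LABEL: HC_CM is proved only modulo the 7 printed citations (2 remaining named inputs: hLiu418 = stmt-HodgeConjecture-24832, h413 = stmt-HodgeConjecture-24833) until rung 0
closes; unconditional local algebra, count-neutral (brick T4c of the (ρ2b′-X) payer plan; the discriminant-module LENGTH `#(Λ^#∕Λ) = q_E^{v_E(N_{M∕E} y)}` and the glue
decomposition T2 are separate files).

## References
* [Serre1979] J.-P. Serre, *Local Fields*, GTM 67 (1979): Ch. III §6 Prop. 11 and Lemma 2 (Euler) (codifferent of a power basis), Ch. III §3 (duality with respect to the trace).
* [Jacobowitz1962] R. Jacobowitz, *Hermitian forms over local fields*, Amer. J. Math. 84 (1962): §4 (hermitian lattices, duals `L^#`, scales and norms; modular lattices).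
-/

set_option autoImplicit false

open WithZero

namespace Literature.NumberTheory.LocalFields.QuadraticOrder

variable {K : Type*} [Field K] [Valued K ℤᵐ⁰] {ρ Θ : K →+* K} {α : K}

/-! ## §0 The ramified frame supplies `ρα ≠ α` and `hint` from base parity alone (REF5 R5-131's by-name discharge) -/

/-- In the RAMIFIED frames a uniformiser is NOT fixed: if `ρ`-fixed nonzero elements have EVEN order and `|α| = exp(−1)`, then `ρ α ≠ α`. [cite: Serre1979, Ch. III §6 Prop. 12] -/
theorem map_ne_self_of_v_eq_exp_neg_one (hfix : ∀ c : K, ρ c = c → c ≠ 0 → Even (log (Valued.v c))) (hvα : Valued.v α = exp (-1 : ℤ)) :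
    ρ α ≠ α := by
  intro hα
  have hα0 : α ≠ 0 := fun h0 => by rw [h0, map_zero] at hvα; exact exp_ne_zero.symm hvα
  obtain ⟨m, hm⟩ := hfix α hα hα0
  rw [hvα, log_exp] at hm
  omega

/-- **`hint` FROM BASE PARITY AND `|α| = exp(−1)` ALONE** (the ramified frames, tame or wild; `ρα ≠ α` is derived, §0): every integer `z` has `|(z − ρz)∕(α − ρα)| ≤ 1` — ★ part II
`v_bCoord_le_one_of_even_log` ∘ `map_ne_self_of_v_eq_exp_neg_one`, i.e. ★ (Π5) `v_fixed_add_fixed_mul_le_one_iff` BY NAME. [cite: Serre1979, Ch. III §6 Prop. 12] -/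
theorem forall_v_bCoord_le_one_of_v_eq_exp_neg_one (hρρ : ∀ x, ρ (ρ x) = x) (hfix : ∀ c : K, ρ c = c → c ≠ 0 → Even (log (Valued.v c)))
    (hvα : Valued.v α = exp (-1 : ℤ)) : ∀ z : K, Valued.v z ≤ 1 → Valued.v ((z - ρ z) / (α - ρ α)) ≤ 1 :=
  fun z hz => v_bCoord_le_one_of_even_log hρρ hfix hvα (map_ne_self_of_v_eq_exp_neg_one hfix hvα) z hz

/-! ## §1 The adjoint involution preserves every order -/

/-- **`Θ` PRESERVES THE ORDER OF CONDUCTOR `c`** (`Θρ = ρΘ`, `Θ` isometric): `Θz − ρΘz = Θ(z − ρz)` has the value of `z − ρz`. [cite: Serre1979, Ch. III §3] -/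
theorem theta_mem_order (hΘρ : ∀ x, Θ (ρ x) = ρ (Θ x)) (hvΘ : ∀ x, Valued.v (Θ x) = Valued.v x) {c z : K}
    (hz : Valued.v z ≤ 1 ∧ Valued.v (z - ρ z) ≤ Valued.v (c * (α - ρ α))) :
    Valued.v (Θ z) ≤ 1 ∧ Valued.v (Θ z - ρ (Θ z)) ≤ Valued.v (c * (α - ρ α)) := by
  refine ⟨by rw [hvΘ]; exact hz.1, ?_⟩
  rw [← hΘρ, ← map_sub, hvΘ]
  exact hz.2

/-- With `ΘΘ = id`, `Θ` maps the order ONTO itself: every element of the order is `Θ` of an element of the order. [cite: Serre1979, Ch. III §3] -/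
theorem exists_theta_eq_of_mem_order (hΘΘ : ∀ x, Θ (Θ x) = x) (hΘρ : ∀ x, Θ (ρ x) = ρ (Θ x)) (hvΘ : ∀ x, Valued.v (Θ x) = Valued.v x) {c z : K}
    (hz : Valued.v z ≤ 1 ∧ Valued.v (z - ρ z) ≤ Valued.v (c * (α - ρ α))) :
    ∃ z', (Valued.v z' ≤ 1 ∧ Valued.v (z' - ρ z') ≤ Valued.v (c * (α - ρ α))) ∧ z = Θ z' :=
  ⟨Θ z, theta_mem_order hΘρ hvΘ hz, (hΘΘ z).symm⟩

/-! ## §2 The hermitian dual of `x₀·(order of conductor c)` for the form `Tr(h·Θ(a)·b)` -/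

/-- **THE HERMITIAN DUAL OF AN ORDER LATTICE, order form.**  For the pairing `(a, b) ↦ Tr(h·Θ(a)·b) = hΘ(a)b + ρ(hΘ(a)b)`: `|Tr(h·Θ(x₀a)·b)| ≤ 1` for EVERY `a` in the order of
conductor `c` iff `c(α − ρα)·(h·Θ(x₀)·b)` lies in that order (`Θ(x₀a) = Θ(x₀)Θ(a)`, `Θ(a)` runs over the whole order by §1, then ★ Euler dual `forall_v_trace_mul_le_one_iff`
of part I at `y := hΘ(x₀)b`). [cite: Serre1979, Ch. III §6 Prop. 11] [cite: Jacobowitz1962, §4] -/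
theorem forall_v_herm_le_one_iff (hρρ : ∀ x, ρ (ρ x) = x) (hvρ : ∀ x, Valued.v (ρ x) = Valued.v x) (hα : ρ α ≠ α) (hα1 : Valued.v α ≤ 1)
    (hint : ∀ z : K, Valued.v z ≤ 1 → Valued.v ((z - ρ z) / (α - ρ α)) ≤ 1)
    (hΘΘ : ∀ x, Θ (Θ x) = x) (hΘρ : ∀ x, Θ (ρ x) = ρ (Θ x)) (hvΘ : ∀ x, Valued.v (Θ x) = Valued.v x)
    {c : K} (hc : ρ c = c) (hc0 : c ≠ 0) (hc1 : Valued.v c ≤ 1) (h x₀ b : K) :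
    (∀ a, (Valued.v a ≤ 1 ∧ Valued.v (a - ρ a) ≤ Valued.v (c * (α - ρ α))) →
        Valued.v (h * Θ (x₀ * a) * b + ρ (h * Θ (x₀ * a) * b)) ≤ 1) ↔
      (Valued.v (c * (α - ρ α) * (h * Θ x₀ * b)) ≤ 1 ∧
        Valued.v (c * (α - ρ α) * (h * Θ x₀ * b) - ρ (c * (α - ρ α) * (h * Θ x₀ * b))) ≤ Valued.v (c * (α - ρ α))) := by
  rw [← forall_v_trace_mul_le_one_iff hρρ hvρ hα hα1 hint hc hc0 hc1 (h * Θ x₀ * b)]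
  have hrew : ∀ a, h * Θ (x₀ * a) * b = Θ a * (h * Θ x₀ * b) := fun a => by rw [map_mul]; ring
  constructor
  · intro H a ha
    obtain ⟨a', ha', rfl⟩ := exists_theta_eq_of_mem_order hΘΘ hΘρ hvΘ ha
    have := H a' ha'
    rwa [hrew] at this
  · intro H a ha
    rw [hrew]
    exact H (Θ a) (theta_mem_order hΘρ hvΘ ha)

/-- **THE HERMITIAN DUAL OF AN ORDER LATTICE, lattice form.**  For `Λ = x₀·(order of conductor c)`: `b` pairs integrally with all of `Λ` under `Tr(h·Θ(x)·b)` iff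
`c(α − ρα)·h·Θ(x₀)·b` lies in the order. [cite: Serre1979, Ch. III §6 Prop. 11] [cite: Jacobowitz1962, §4] -/
theorem forall_mem_v_herm_le_one_iff (hρρ : ∀ x, ρ (ρ x) = x) (hvρ : ∀ x, Valued.v (ρ x) = Valued.v x) (hα : ρ α ≠ α) (hα1 : Valued.v α ≤ 1)
    (hint : ∀ z : K, Valued.v z ≤ 1 → Valued.v ((z - ρ z) / (α - ρ α)) ≤ 1)
    (hΘΘ : ∀ x, Θ (Θ x) = x) (hΘρ : ∀ x, Θ (ρ x) = ρ (Θ x)) (hvΘ : ∀ x, Valued.v (Θ x) = Valued.v x)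
    {c : K} (hc : ρ c = c) (hc0 : c ≠ 0) (hc1 : Valued.v c ≤ 1) (h : K) {Λ : AddSubgroup K} {x₀ : K}
    (hΛ : ∀ x, x ∈ Λ ↔ ∃ a, (Valued.v a ≤ 1 ∧ Valued.v (a - ρ a) ≤ Valued.v (c * (α - ρ α))) ∧ x = x₀ * a) (b : K) :
    (∀ x ∈ Λ, Valued.v (h * Θ x * b + ρ (h * Θ x * b)) ≤ 1) ↔
      (Valued.v (c * (α - ρ α) * (h * Θ x₀ * b)) ≤ 1 ∧
        Valued.v (c * (α - ρ α) * (h * Θ x₀ * b) - ρ (c * (α - ρ α) * (h * Θ x₀ * b))) ≤ Valued.v (c * (α - ρ α))) := by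
  rw [← forall_v_herm_le_one_iff hρρ hvρ hα hα1 hint hΘΘ hΘρ hvΘ hc hc0 hc1 h x₀ b]
  constructor
  · intro H a ha
    exact H (x₀ * a) ((hΛ _).2 ⟨a, ha, rfl⟩)
  · intro H x hx
    obtain ⟨a, ha, rfl⟩ := (hΛ x).1 hx
    exact H a ha

/-- The algebra of the `y`-form: `c(α − ρα)·(h·Θ(x₀)·b)` lies in the order iff `b = y⁻¹·(x₀·a)` for some `a` in the order, where **`y = h·x₀Θ(x₀)·c(α − ρα)`** (`x₀, h ≠ 0`;
`c(α − ρα)hΘ(x₀)b = x₀⁻¹·y·b`). [cite: Jacobowitz1962, §4] -/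
theorem conductor_mul_herm_mem_order_iff_exists (hα : ρ α ≠ α) {c : K} (hc0 : c ≠ 0) {h x₀ : K} (hh : h ≠ 0) (hx₀ : x₀ ≠ 0) (hΘx₀ : Θ x₀ ≠ 0) (b : K) :
    (Valued.v (c * (α - ρ α) * (h * Θ x₀ * b)) ≤ 1 ∧
        Valued.v (c * (α - ρ α) * (h * Θ x₀ * b) - ρ (c * (α - ρ α) * (h * Θ x₀ * b))) ≤ Valued.v (c * (α - ρ α))) ↔
      ∃ a, (Valued.v a ≤ 1 ∧ Valued.v (a - ρ a) ≤ Valued.v (c * (α - ρ α))) ∧ b = (h * (x₀ * Θ x₀) * (c * (α - ρ α)))⁻¹ * (x₀ * a) := by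
  have hd : α - ρ α ≠ 0 := sub_ne_zero.2 (Ne.symm hα)
  have hy : h * (x₀ * Θ x₀) * (c * (α - ρ α)) ≠ 0 := mul_ne_zero (mul_ne_zero hh (mul_ne_zero hx₀ hΘx₀)) (mul_ne_zero hc0 hd)
  have key : ∀ a, b = (h * (x₀ * Θ x₀) * (c * (α - ρ α)))⁻¹ * (x₀ * a) ↔ a = c * (α - ρ α) * (h * Θ x₀ * b) := by
    intro a
    constructor
    · intro hb; rw [hb]; field_simp
    · intro ha; rw [ha]; field_simp
  constructor
  · intro H; exact ⟨_, H, (key _).2 rfl⟩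
  · rintro ⟨a, ha, hb⟩
    rwa [← (key a).1 hb]

/-- **`Λ^# = y⁻¹Λ`** for `Λ = x₀·(order of conductor c)`, `y = h·x₀Θ(x₀)·c(α − ρα)` (`h, x₀ ≠ 0`): `b` pairs integrally with `Λ` under `Tr(h·Θ(x)·b)` iff `b ∈ y⁻¹·Λ`, i.e.
`b = y⁻¹·(x₀·a)` with `a` in the order — the dual of `x𝒪_j` is `y⁻¹x𝒪_j` with `y = h·N_{M∕K♮}(x)·ϖ^j(α − ρα)` (PAYER-PLAN D4). [cite: Jacobowitz1962, §4] [cite: Serre1979, Ch. III §6 Prop. 11] -/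
theorem forall_mem_v_herm_le_one_iff_exists (hρρ : ∀ x, ρ (ρ x) = x) (hvρ : ∀ x, Valued.v (ρ x) = Valued.v x) (hα : ρ α ≠ α) (hα1 : Valued.v α ≤ 1)
    (hint : ∀ z : K, Valued.v z ≤ 1 → Valued.v ((z - ρ z) / (α - ρ α)) ≤ 1)
    (hΘΘ : ∀ x, Θ (Θ x) = x) (hΘρ : ∀ x, Θ (ρ x) = ρ (Θ x)) (hvΘ : ∀ x, Valued.v (Θ x) = Valued.v x)
    {c : K} (hc : ρ c = c) (hc0 : c ≠ 0) (hc1 : Valued.v c ≤ 1) {h : K} (hh : h ≠ 0) {Λ : AddSubgroup K} {x₀ : K} (hx₀ : x₀ ≠ 0)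
    (hΛ : ∀ x, x ∈ Λ ↔ ∃ a, (Valued.v a ≤ 1 ∧ Valued.v (a - ρ a) ≤ Valued.v (c * (α - ρ α))) ∧ x = x₀ * a) (b : K) :
    (∀ x ∈ Λ, Valued.v (h * Θ x * b + ρ (h * Θ x * b)) ≤ 1) ↔
      ∃ a, (Valued.v a ≤ 1 ∧ Valued.v (a - ρ a) ≤ Valued.v (c * (α - ρ α))) ∧ b = (h * (x₀ * Θ x₀) * (c * (α - ρ α)))⁻¹ * (x₀ * a) := by
  have hΘx₀ : Θ x₀ ≠ 0 := (map_ne_zero Θ).2 hx₀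
  rw [forall_mem_v_herm_le_one_iff hρρ hvρ hα hα1 hint hΘΘ hΘρ hvΘ hc hc0 hc1 h hΛ b,
    conductor_mul_herm_mem_order_iff_exists hα hc0 hh hx₀ hΘx₀ b]

/-! ## §3 Integrality, depth ∕ modularity and scale of `x₀·(order)` in terms of `y = h·x₀Θ(x₀)·c(α − ρα)` -/

/-- **INTEGRALITY `Λ ⊆ Λ^# ⟺ y ∈ 𝒪_j`**: the pairing `Tr(h·Θ(x)·x′)` is integral on `Λ × Λ` (`Λ = x₀·(order of conductor c)`) iff `y = h·x₀Θ(x₀)·c(α − ρα)` lies in the order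
(the dual condition for `x′ = x₀a′` reads «`y·a′` in the order», and ★ `forall_mul_mem_order_iff`). [cite: Jacobowitz1962, §4] -/
theorem forall_mem_forall_mem_v_herm_le_one_iff (hρρ : ∀ x, ρ (ρ x) = x) (hvρ : ∀ x, Valued.v (ρ x) = Valued.v x) (hα : ρ α ≠ α) (hα1 : Valued.v α ≤ 1)
    (hint : ∀ z : K, Valued.v z ≤ 1 → Valued.v ((z - ρ z) / (α - ρ α)) ≤ 1)
    (hΘΘ : ∀ x, Θ (Θ x) = x) (hΘρ : ∀ x, Θ (ρ x) = ρ (Θ x)) (hvΘ : ∀ x, Valued.v (Θ x) = Valued.v x)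
    {c : K} (hc : ρ c = c) (hc0 : c ≠ 0) (hc1 : Valued.v c ≤ 1) (h : K) {Λ : AddSubgroup K} {x₀ : K}
    (hΛ : ∀ x, x ∈ Λ ↔ ∃ a, (Valued.v a ≤ 1 ∧ Valued.v (a - ρ a) ≤ Valued.v (c * (α - ρ α))) ∧ x = x₀ * a) :
    (∀ x ∈ Λ, ∀ x' ∈ Λ, Valued.v (h * Θ x * x' + ρ (h * Θ x * x')) ≤ 1) ↔
      (Valued.v (h * (x₀ * Θ x₀) * (c * (α - ρ α))) ≤ 1 ∧
        Valued.v (h * (x₀ * Θ x₀) * (c * (α - ρ α)) - ρ (h * (x₀ * Θ x₀) * (c * (α - ρ α)))) ≤ Valued.v (c * (α - ρ α))) := by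
  rw [← forall_mul_mem_order_iff hvρ c (h * (x₀ * Θ x₀) * (c * (α - ρ α)))]
  have hrew : ∀ a, c * (α - ρ α) * (h * Θ x₀ * (x₀ * a)) = h * (x₀ * Θ x₀) * (c * (α - ρ α)) * a := fun a => by ring
  constructor
  · intro H a ha
    have H' := (forall_mem_v_herm_le_one_iff hρρ hvρ hα hα1 hint hΘΘ hΘρ hvΘ hc hc0 hc1 h hΛ (x₀ * a)).1
      (fun x hx => H x hx (x₀ * a) ((hΛ _).2 ⟨a, ha, rfl⟩))
    rwa [hrew] at H'
  · intro H x hx x' hx'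
    obtain ⟨a, ha, rfl⟩ := (hΛ x').1 hx'
    revert x hx
    rw [forall_mem_v_herm_le_one_iff hρρ hvρ hα hα1 hint hΘΘ hΘρ hvΘ hc hc0 hc1 h hΛ (x₀ * a), hrew]
    exact H a ha

/-- **DEPTH ∕ MODULARITY `μ·Λ^# ⊆ Λ ⟺ μ∕y ∈ 𝒪_j`** (`Λ = x₀·(order)`, `h, x₀ ≠ 0`, `y = h·x₀Θ(x₀)·c(α − ρα)`): every `b` pairing integrally with `Λ` has `μ·b ∈ Λ` iff `μ∕y`
lies in the order (`Λ^# = y⁻¹Λ` and ★ `forall_mul_mem_iff_of_eq_mul_order`) — the census's DEPTH CONDITION `(λ − u)Λ_W^# ⊆ Λ_W ⟺ (λ − u) ∈ y·𝒪_j` (PAYER-PLAN D4).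
[cite: Jacobowitz1962, §4] -/
theorem forall_dual_mul_mem_iff (hρρ : ∀ x, ρ (ρ x) = x) (hvρ : ∀ x, Valued.v (ρ x) = Valued.v x) (hα : ρ α ≠ α) (hα1 : Valued.v α ≤ 1)
    (hint : ∀ z : K, Valued.v z ≤ 1 → Valued.v ((z - ρ z) / (α - ρ α)) ≤ 1)
    (hΘΘ : ∀ x, Θ (Θ x) = x) (hΘρ : ∀ x, Θ (ρ x) = ρ (Θ x)) (hvΘ : ∀ x, Valued.v (Θ x) = Valued.v x)
    {c : K} (hc : ρ c = c) (hc0 : c ≠ 0) (hc1 : Valued.v c ≤ 1) {h : K} (hh : h ≠ 0) {Λ : AddSubgroup K} {x₀ : K} (hx₀ : x₀ ≠ 0)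
    (hΛ : ∀ x, x ∈ Λ ↔ ∃ a, (Valued.v a ≤ 1 ∧ Valued.v (a - ρ a) ≤ Valued.v (c * (α - ρ α))) ∧ x = x₀ * a) (μ : K) :
    (∀ b, (∀ x ∈ Λ, Valued.v (h * Θ x * b + ρ (h * Θ x * b)) ≤ 1) → μ * b ∈ Λ) ↔
      (Valued.v (μ / (h * (x₀ * Θ x₀) * (c * (α - ρ α)))) ≤ 1 ∧
        Valued.v (μ / (h * (x₀ * Θ x₀) * (c * (α - ρ α))) - ρ (μ / (h * (x₀ * Θ x₀) * (c * (α - ρ α))))) ≤ Valued.v (c * (α - ρ α))) := by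
  have hd : α - ρ α ≠ 0 := sub_ne_zero.2 (Ne.symm hα)
  have hΘx₀ : Θ x₀ ≠ 0 := (map_ne_zero Θ).2 hx₀
  set y : K := h * (x₀ * Θ x₀) * (c * (α - ρ α)) with hy
  have hy0 : y ≠ 0 := mul_ne_zero (mul_ne_zero hh (mul_ne_zero hx₀ hΘx₀)) (mul_ne_zero hc0 hd)
  rw [← forall_mul_mem_iff_of_eq_mul_order hvρ hx₀ hΛ (μ / y)]
  constructor
  · intro H x hx
    obtain ⟨a, ha, rfl⟩ := (hΛ x).1 hx
    have hb := H (y⁻¹ * (x₀ * a))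
      ((forall_mem_v_herm_le_one_iff_exists hρρ hvρ hα hα1 hint hΘΘ hΘρ hvΘ hc hc0 hc1 hh hx₀ hΛ _).2 ⟨a, ha, rfl⟩)
    rwa [← mul_assoc, ← div_eq_mul_inv] at hb
  · intro H b hb
    obtain ⟨a, ha, rfl⟩ := (forall_mem_v_herm_le_one_iff_exists hρρ hvρ hα hα1 hint hΘΘ hΘρ hvΘ hc hc0 hc1 hh hx₀ hΛ b).1 hb
    have := H (x₀ * a) ((hΛ _).2 ⟨a, ha, rfl⟩)
    rwa [← mul_assoc, ← div_eq_mul_inv]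

/-- **SCALE `Λ ⊆ e·Λ^# ⟺ y∕e ∈ 𝒪_j`** (`e ≠ 0`; `Λ = x₀·(order)`, `h, x₀ ≠ 0`): every element of `Λ` is `e·b` with `b` pairing integrally with `Λ` iff `y∕e` lies in the order —
at `e = 1` integrality again, and `Λ` is GRAM-PRIMITIVE (Gram matrix not divisible by `ϖ_E`) iff this FAILS at `e = ϖ_E`. [cite: Jacobowitz1962, §4] -/
theorem forall_mem_exists_dual_eq_mul_iff (hρρ : ∀ x, ρ (ρ x) = x) (hvρ : ∀ x, Valued.v (ρ x) = Valued.v x) (hα : ρ α ≠ α) (hα1 : Valued.v α ≤ 1)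
    (hint : ∀ z : K, Valued.v z ≤ 1 → Valued.v ((z - ρ z) / (α - ρ α)) ≤ 1)
    (hΘΘ : ∀ x, Θ (Θ x) = x) (hΘρ : ∀ x, Θ (ρ x) = ρ (Θ x)) (hvΘ : ∀ x, Valued.v (Θ x) = Valued.v x)
    {c : K} (hc : ρ c = c) (hc0 : c ≠ 0) (hc1 : Valued.v c ≤ 1) {h : K} (hh : h ≠ 0) {Λ : AddSubgroup K} {x₀ : K} (hx₀ : x₀ ≠ 0)
    (hΛ : ∀ x, x ∈ Λ ↔ ∃ a, (Valued.v a ≤ 1 ∧ Valued.v (a - ρ a) ≤ Valued.v (c * (α - ρ α))) ∧ x = x₀ * a) {e : K} (he : e ≠ 0) :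
    (∀ x ∈ Λ, ∃ b, (∀ x' ∈ Λ, Valued.v (h * Θ x' * b + ρ (h * Θ x' * b)) ≤ 1) ∧ x = e * b) ↔
      (Valued.v (h * (x₀ * Θ x₀) * (c * (α - ρ α)) / e) ≤ 1 ∧
        Valued.v (h * (x₀ * Θ x₀) * (c * (α - ρ α)) / e - ρ (h * (x₀ * Θ x₀) * (c * (α - ρ α)) / e)) ≤ Valued.v (c * (α - ρ α))) := by
  have hd : α - ρ α ≠ 0 := sub_ne_zero.2 (Ne.symm hα)
  have hΘx₀ : Θ x₀ ≠ 0 := (map_ne_zero Θ).2 hx₀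
  set y : K := h * (x₀ * Θ x₀) * (c * (α - ρ α)) with hy
  have hy0 : y ≠ 0 := mul_ne_zero (mul_ne_zero hh (mul_ne_zero hx₀ hΘx₀)) (mul_ne_zero hc0 hd)
  rw [← forall_mul_mem_order_iff hvρ c (y / e)]
  constructor
  · intro H a ha
    obtain ⟨b, hb, hxb⟩ := H (x₀ * a) ((hΛ _).2 ⟨a, ha, rfl⟩)
    obtain ⟨a', ha', rfl⟩ := (forall_mem_v_herm_le_one_iff_exists hρρ hvρ hα hα1 hint hΘΘ hΘρ hvΘ hc hc0 hc1 hh hx₀ hΛ b).1 hb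
    have haa : y / e * a = a' := by
      have := hxb
      field_simp at this
      rw [div_mul_eq_mul_div, div_eq_iff he]
      linear_combination this
    rw [haa]; exact ha'
  · intro H x hx
    obtain ⟨a, ha, rfl⟩ := (hΛ x).1 hx
    refine ⟨y⁻¹ * (x₀ * (y / e * a)),
      (forall_mem_v_herm_le_one_iff_exists hρρ hvρ hα hα1 hint hΘΘ hΘρ hvΘ hc hc0 hc1 hh hx₀ hΛ _).2 ⟨y / e * a, H a ha, rfl⟩, ?_⟩
    field_simp

end Literature.NumberTheory.LocalFields.QuadraticOrder
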